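import Mathlib.Analysis.SpecialFunctions.Pow.Real
import HarnessLib

/-!
# Subdividing a shell into three sub-shells of equal aspect ratio (the cube-root trick)

Elementary real-variable bookkeeping for Aizenman–Burchard-type shell estimates with a
short-distance cutoff (M. Aizenman, A. Burchard, Duke Math. J. 99 (1999) §1.b, §5; folklore):
a shell `D(x; ρ, R)` is cut at the radii `ρ^{2/3}R^{1/3}`, `ρ^{1/3}R^{2/3}` into three sub-shells of
aspect ratio `(R/ρ)^{1/3} = 1/u`, `u := (ρ/R)^{1/3}`; two marked points miss at least one of them
(`exists_subshell`); and the lattice parameters attached to the chosen sub-shell satisfy the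
inequalities consumed by the arc bounds (`subshell_parameters`). No definitions.
-/

noncomputable section

namespace Literature.Probability.RandomPlanarGeometry

/-- `u = θ^{1/3}` for `0 < θ ≤ 1`: `0 < u ≤ 1`, `u³ = θ`, `θ^{7/3} = u⁷`. [folklore] -/
theorem rpow_third_facts {θ : ℝ} (h0 : 0 < θ) (h1 : θ ≤ 1) :
    0 < θ ^ (1 / 3 : ℝ) ∧ θ ^ (1 / 3 : ℝ) ≤ 1 ∧ (θ ^ (1 / 3 : ℝ)) ^ 3 = θ ∧
      θ ^ (7 / 3 : ℝ) = (θ ^ (1 / 3 : ℝ)) ^ 7 := by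
  refine ⟨Real.rpow_pos_of_pos h0 _, Real.rpow_le_one h0.le h1 (by norm_num), ?_, ?_⟩
  · rw [← Real.rpow_natCast, ← Real.rpow_mul h0.le]; norm_num
  · rw [← Real.rpow_natCast, ← Real.rpow_mul h0.le]; norm_num

/-- **Pigeonhole over three sub-shells.** For `0 < u ≤ 1` the three annuli `(ρ, ρ/u]`,
`(ρ/u, ρ/u²]`, `(ρ/u², ρ/u³]` are disjoint, so two numbers `dA, dB` (distances of two marked points)
miss one of them: there is `s ∈ {ρ, ρ/u, ρ/u²}` with `dA, dB ∉ (s, s/u]`. [folklore] -/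
theorem exists_subshell (ρ u dA dB : ℝ) (hρ : 0 < ρ) (hu0 : 0 < u) (hu1 : u ≤ 1) :
    ∃ s : ℝ, ρ ≤ s ∧ s / u ≤ ρ / u ^ 3 ∧ s ≤ ρ / u ^ 2 ∧
      (dA ≤ s ∨ s / u < dA) ∧ (dB ≤ s ∨ s / u < dB) := by
  have h1 : ρ ≤ ρ / u := by rw [le_div_iff₀ hu0]; nlinarith
  have hu2 : 0 < u ^ 2 := by positivity
  have hu3 : 0 < u ^ 3 := by positivity
  have e1 : ρ / u / u = ρ / u ^ 2 := by rw [div_div, sq]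
  have e2 : ρ / u ^ 2 / u = ρ / u ^ 3 := by rw [div_div, ← pow_succ]
  have h2 : ρ / u ≤ ρ / u ^ 2 := by
    rw [← e1, le_div_iff₀ hu0]; nlinarith [div_pos hρ hu0]
  have h3 : ρ / u ^ 2 ≤ ρ / u ^ 3 := by
    rw [← e2, le_div_iff₀ hu0]; nlinarith [div_pos hρ hu2]
  by_cases hA0 : dA ≤ ρ ∨ ρ / u < dA
  · by_cases hB0 : dB ≤ ρ ∨ ρ / u < dB
    · exact ⟨ρ, le_rfl, h2.trans h3, h1.trans h2, hA0, hB0⟩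
    · -- `dB` is in the first annulus, hence in no other
      push Not at hB0
      by_cases hA1 : dA ≤ ρ / u ∨ ρ / u / u < dA
      · exact ⟨ρ / u, h1, by rw [e1]; exact h3, h2, hA1, Or.inl hB0.2⟩
      · push Not at hA1
        exact ⟨ρ / u ^ 2, h1.trans h2, e2.le, le_rfl, Or.inl (e1 ▸ hA1.2), Or.inl (hB0.2.trans h2)⟩
  · push Not at hA0
    -- `dA` is in the first annulus
    by_cases hB1 : dB ≤ ρ / u ∨ ρ / u / u < dB
    · exact ⟨ρ / u, h1, by rw [e1]; exact h3, h2, Or.inl hA0.2, hB1⟩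
    · push Not at hB1
      exact ⟨ρ / u ^ 2, h1.trans h2, e2.le, le_rfl, Or.inl (hA0.2.trans h2), Or.inl (e1 ▸ hB1.2)⟩

/-- **The lattice parameters of the chosen sub-shell.** With mesh `δ ≤ s` (inner radius), aspect
`1/u ≥ 19` and `≥ 4N₀ + 3`, set (in lattice units) `N := s/(uδ) - 3` (virgin radius), inner radius
`n := max (s/δ + 3) N₀`, event radii `r := s/δ + 2`, `R := N - 1`. Then all the side conditions of
the arc bounds and of the virginization lemmas hold, and `n/N ≤ max 8 (2N₀) · u`. [folklore] -/
theorem subshell_parameters {δ s u N₀ : ℝ} (hδ : 0 < δ) (hδs : δ ≤ s) (hu : 0 < u) (hN₀ : 0 < N₀)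
    (h19 : 19 ≤ 1 / u) (hΛ : 4 * N₀ + 3 ≤ 1 / u) :
    0 < s / u / δ - 3 ∧ N₀ ≤ max (s / δ + 3) N₀ ∧ 4 * max (s / δ + 3) N₀ ≤ s / u / δ - 3 ∧
    s / δ + 2 + 1 < s / u / δ - 3 - 1 ∧ s / δ + 2 + 1 ≤ max (s / δ + 3) N₀ ∧
    (s / u / δ - 3) / 2 + 1 ≤ s / u / δ - 3 - 1 ∧ max (s / δ + 3) N₀ ≤ s / u / δ - 3 ∧
    max (s / δ + 3) N₀ / (s / u / δ - 3) ≤ max 8 (2 * N₀) * u ∧ 6 * δ ≤ s / u := by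
  -- `p := s/δ ≥ 1`, `q := s/(uδ) = p/u ≥ 19 p`
  set p := s / δ with hp
  have hp1 : 1 ≤ p := by rw [hp, le_div_iff₀ hδ]; linarith
  have hq : s / u / δ = p * (1 / u) := by rw [hp]; field_simp
  set w := 1 / u with hw
  have hw19 : 19 ≤ w := h19
  have hqp : 19 * p ≤ p * w := by nlinarith
  have hqN : (4 * N₀ + 3) * p ≤ p * w := by nlinarith
  have hqN' : 4 * N₀ + 3 ≤ p * w := le_trans (by nlinarith) hqN
  rw [hq]
  have hu' : u = 1 / w := by rw [hw, one_div_one_div]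
  have hwpos : 0 < w := by linarith
  refine ⟨by nlinarith, le_max_right _ _, ?_, by nlinarith, ?_, by nlinarith, ?_, ?_, ?_⟩
  · rcases le_total (p + 3) N₀ with h | h
    · rw [max_eq_right h]; nlinarith
    · rw [max_eq_left h]; nlinarith
  · exact le_trans (by linarith) (le_max_left _ _)
  · rcases le_total (p + 3) N₀ with h | h
    · rw [max_eq_right h]; nlinarith
    · rw [max_eq_left h]; nlinarith
  · -- `n / N ≤ max 8 (2 N₀) u`
    have hNpos : 0 < p * w - 3 := by nlinarith
    rw [div_le_iff₀ hNpos, hu']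
    rcases le_total (p + 3) N₀ with h | h
    · rw [max_eq_right h]
      have : 2 * N₀ * (1 / w) * (p * w - 3) ≤ max 8 (2 * N₀) * (1 / w) * (p * w - 3) :=
        mul_le_mul_of_nonneg_right (mul_le_mul_of_nonneg_right (le_max_right _ _)
          (by positivity)) hNpos.le
      refine le_trans ?_ this
      have e : 2 * N₀ * (1 / w) * (p * w - 3) = 2 * N₀ * (p - 3 / w) := by field_simp
      rw [e]
      have : 3 / w ≤ 3 / 19 := div_le_div_of_nonneg_left (by norm_num) (by norm_num) hw19
      nlinarith
    · rw [max_eq_left h]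
      have : 8 * (1 / w) * (p * w - 3) ≤ max 8 (2 * N₀) * (1 / w) * (p * w - 3) :=
        mul_le_mul_of_nonneg_right (mul_le_mul_of_nonneg_right (le_max_left _ _)
          (by positivity)) hNpos.le
      refine le_trans ?_ this
      have e : 8 * (1 / w) * (p * w - 3) = 8 * (p - 3 / w) := by field_simp
      rw [e]
      have : 3 / w ≤ 3 / 19 := div_le_div_of_nonneg_left (by norm_num) (by norm_num) hw19
      nlinarith
  · -- `6 δ ≤ s / u`
    have : s / u = p * w * δ := by rw [hp, hw]; field_simp
    rw [this]; nlinarith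

end Literature.Probability.RandomPlanarGeometry

end
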